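import Literature.AlgebraicGeometry.HodgeTheory.HodgeFiltrationModels
import Literature.AlgebraicGeometry.Motives.VarietiesProperProofs
import Literature.AlgebraicGeometry.Motives.AlgPointsProperProofs
import Literature.NumberTheory.Transcendental.AnalytificationUniquenessProofs
import Literature.NumberTheory.Transcendental.ComplexFormsPullback
import HarnessLib

/-!
# Independence of the Hodge model: reduction to the rigidity of natural de Rham comparisons

Family `hodge`, layer `Literature/AlgebraicGeometry/HodgeTheory`. Companion to
`HodgeFiltrationModels`, whose named fact `hodgePQ_independent_of_hodgeModel` ("for a smooth
projective `X`, whether the pull-back of `c ∈ Hᵏ(X(ℂ); ℂ)` lies in the piece `H^{p,q}` of a Hodge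
model does not depend on the model") is assembled, in its docstring, from three ingredients:

1. two analytifications of `X` differ by a biholomorphism over `X(ℂ)` (Serre, GAGA §2 n°5
   Prop. 2) — PROVED in the tree: `IsAnalytification.unique_holds`
   (`Literature/NumberTheory/Transcendental/AnalytificationUniquenessProofs`); here
   `HodgeModel.exists_biholomorph`;
2. a biholomorphism identifies the subspaces `H^{p,q} ⊆ H^k_dR` spanned by the classes of closed
   `(p,q)`-forms (Voisin I §7.3.2) — PROVED in the tree: `hodgePQ_map_eq_of_leftInverse`
   (`Literature/NumberTheory/Transcendental/ComplexFormsPullback`), under the pull-back calculus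
   `[PullbackFacts …]` of `FormsAlgebra` (named facts `IsSmoothFormPullback`, `MextDerivPullback`);
3. a RIGIDITY statement: the two natural de Rham comparison families of the two models, read on
   the common carrier through the biholomorphism, differ by a scalar. This is NOT a printed
   theorem; the docstring of the fact sketches its derivation from Thom's realisation of rational
   homology classes of a compact orientable manifold by oriented submanifolds (Comment. Math.
   Helv. 28 (1954), Thm. II.29 «Pour toute classe d'homologie entière `z` d'une variété orientable
   `Vⁿ`, il existe un entier non nul `N` tel que la classe multiple `N·z` soit réalisable par une
   sous-variété», Cor. II.30 «Les groupes d'homologie à coefficients réels ou rationnels d'une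
   variété orientable `Vⁿ` admettent pour bases des systèmes d'éléments représentés par des
   sous-variétés»), degree-one collapse maps onto spheres, tubular neighbourhoods and universal
   coefficients — none of which the tree has in proved form.

This file makes the decomposition FORMAL: it isolates ingredient 3 as an explicit proposition
`NaturalDeRhamComparisonRigidity` (pure differential topology: no schemes, no Hodge theory) and
PROVES the reduction

  `hodgePQ_independent_of_hodgeModel_of_rigidity :
      NaturalDeRhamComparisonRigidity → (∀ …, PullbackFacts 𝓘(ℝ, E) M 𝓘(ℝ, E') N ℂ) →
        hodgePQ_independent_of_hodgeModel`,

so that the trust base of the named fact is exactly {rigidity, pull-back calculus of smooth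
forms}, ingredients 1 and 2 being theorems. The proof: with `h : A.carrier ≃ A'.carrier` the
biholomorphism over `X(ℂ)` (1), `A.pullback = h^* ∘ A'.pullback` on singular cohomology
(`HodgeModel.pullback_eq_map_pullback`) and `H^{p,q}(A.carrier) = h^*_dR H^{p,q}(A'.carrier)` (2);
so `h^*(A'.pullback c) = e_A(h^*_dR w)` for some `w ∈ H^{p,q}(A'.carrier)`; rigidity gives
`h^*(e_{A'} w) = r • e_A(h^*_dR w) = h^*(r • A'.pullback c)`, `h^*` is injective, hence
`A'.pullback c = r⁻¹ • e_{A'} w ∈ e_{A'}(H^{p,q})` (and `A'.pullback c = 0` if `r = 0`).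

Deliberately NOT here: any attempt at ingredient 3 (an XL programme on the tree's singular
homology: Thom realisability, tubular neighbourhoods, smoothing), and the discharge of
`PullbackFacts` (its own named facts, Warner 2.22–2.23).

## References

* J.-P. Serre, *Géométrie algébrique et géométrie analytique*, Ann. Inst. Fourier 6 (1956), §2
  n°5 Prop. 2.
* C. Voisin, *Hodge Theory and Complex Algebraic Geometry I* (2002), §7.3.2.
* R. Thom, *Quelques propriétés globales des variétés différentiables*, Comment. Math. Helv. 28
  (1954), Thm. II.29, Cor. II.30.
* A. Hatcher, *Algebraic Topology* (2002), §3.1 (functoriality of singular cohomology).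
-/

noncomputable section

open scoped Manifold ContDiff
open CategoryTheory
open Literature.NumberTheory.Transcendental (IsAnalytification ComplexDeRhamIsoFamily
  complexDeRhamCohomology PullbackFacts)

namespace Literature.AlgebraicGeometry.HodgeTheory

section HodgeTheory

variable {n : ℕ} {X : Motives.SchemeOver ℂ}

/-! ### The comparison biholomorphism between two Hodge models -/

namespace HodgeModel

/-- **Two Hodge models of a smooth projective `X` are biholomorphic over `X(ℂ)`**: there is a
homeomorphism `h : A.carrier ≃ₜ A'.carrier`, holomorphic with holomorphic inverse, with
`A'.toComplexPoints ∘ h = A.toComplexPoints`. This is the uniqueness of the analytification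
(Serre, GAGA §2 n°5 Prop. 2), proved in the tree as `IsAnalytification.unique_holds`, applied to
the two analytifications `A.isAnalytification`, `A'.isAnalytification` (`X` is smooth of relative
dimension `n` and locally of finite type, being smooth projective).
[cite: SerreGAGA1956, §2 n°5 Prop. 2 (unicité de X^h)] -/
theorem exists_biholomorph (hX : Motives.IsSmoothProjective n X) (A A' : HodgeModel n X) :
    ∃ h : A.carrier ≃ₜ A'.carrier,
      MDifferentiable 𝓘(ℂ, A.model) 𝓘(ℂ, A'.model) h ∧
      MDifferentiable 𝓘(ℂ, A'.model) 𝓘(ℂ, A.model) h.symm ∧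
      A'.toComplexPoints ∘ h = A.toComplexPoints := by
  haveI : AlgebraicGeometry.IsProper X.hom := Motives.IsSmoothProjective.isProper_holds hX
  haveI : AlgebraicGeometry.SmoothOfRelativeDimension n X.hom := hX.smoothOfRelativeDimension
  exact IsAnalytification.unique_holds A.isAnalytification A'.isAnalytification

/-- Along a map `h` over `X(ℂ)` between the carriers of two Hodge models, the pull-backs to
singular cohomology compose: `A.pullback = h^* ∘ A'.pullback` (contravariant functoriality of
singular cohomology, Hatcher §3.1). [cite: HatcherAT2002, §3.1] -/
theorem pullback_eq_map_pullback (A A' : HodgeModel n X) (h : A.carrier ≃ₜ A'.carrier)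
    (hcomm : A'.toComplexPoints ∘ h = A.toComplexPoints) (k : ℕ)
    (c : Literature.AlgebraicTopology.SingularHomology.singularCohomology ℂ ℂ (Motives.ComplexPoints X) k) :
    A.pullback k c =
      Literature.AlgebraicTopology.SingularHomology.singularCohomology.map ℂ ℂ ⟨h, h.continuous⟩ k
        (A'.pullback k c) := by
  have hc : (⟨A.toComplexPoints, A.isAnalytification.isHomeomorph.continuous⟩ :
        C(A.carrier, Motives.ComplexPoints X)) =
      (⟨A'.toComplexPoints, A'.isAnalytification.isHomeomorph.continuous⟩ :
        C(A'.carrier, Motives.ComplexPoints X)).comp ⟨h, h.continuous⟩ := by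
    refine ContinuousMap.ext fun m ↦ ?_
    exact (congrFun hcomm m).symm
  change Literature.AlgebraicTopology.SingularHomology.singularCohomology.map ℂ ℂ
      ⟨A.toComplexPoints, A.isAnalytification.isHomeomorph.continuous⟩ k c = _
  rw [hc, Literature.AlgebraicTopology.SingularHomology.singularCohomology.map_comp]
  rfl

end HodgeModel

/-! ### The residual hypothesis: rigidity of natural de Rham comparisons -/

/-- **Rigidity of natural de Rham comparisons across a diffeomorphism** (the residual, UNPRINTED
ingredient of `hodgePQ_independent_of_hodgeModel`, isolated as a proposition of pure differential
topology so that the reduction `hodgePQ_independent_of_hodgeModel_of_rigidity` can be stated;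
nothing else in the tree should take it as a hypothesis). For finite-dimensional complex model
spaces `E`, `E'`, natural complex de Rham comparison families `e` over the manifolds charted on
`E` and `e'` over those charted on `E'` (`ComplexDeRhamIsoFamily.IsNatural`), compact Hausdorff
complex manifolds `M` (charted on `E`) and `M'` (charted on `E'`) with their underlying real `C^∞`
structures, and a homeomorphism `h : M ≃ₜ M'` which is `C^∞` with `C^∞` inverse: in each degree
`k` the two comparisons read on `M` differ by a scalar, `h^* ∘ e'_{M'} = r • (e_M ∘ h^*_dR)` on
`H^k_dR(M'; ℂ)` for some `r : ℂ`. Equivalently: the automorphism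
`e'_{M'} ∘ (h^*_dR)⁻¹ ∘ e_M⁻¹ ∘ h^*` of `Hᵏ(M'; ℂ)` is a scalar. Sketch of the expected proof (not
in the tree): transporting `e` along a `ℂ`-linear isomorphism `E ≃ E'` makes that automorphism
natural for `C^∞` maps of `E'`-manifolds; a natural automorphism of `Hᵏ(−; ℂ)` is a scalar on a
tubular neighbourhood `T ≃ V` of a closed connected oriented `k`-submanifold `V ⊂ M'`
(`Hᵏ(T; ℂ) ≅ ℂ`), the same scalar for all `V` (a degree-one collapse `V → Sᵏ` composed with the
tubular projection maps `T` to a standard test manifold, `Sᵏ × ℝ²ⁿ⁻ᵏ` or `S²ⁿ`, charted on `E'`,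
inducing an isomorphism on `Hᵏ(−; ℂ) ≅ ℂ`), hence that scalar on
`Hᵏ(M'; ℂ)` because the classes of oriented submanifolds span `H_k(M'; ℚ)` (Thom 1954,
Thm. II.29 / Cor. II.30) and `Hᵏ(M'; ℂ) = Hom(H_k(M'; ℚ), ℂ)`. Status: an assembled folklore
consequence of the cited theorem of Thom, not a statement printed as such. [folklore] -/
def NaturalDeRhamComparisonRigidity : Prop :=
  ∀ (E : Type) [NormedAddCommGroup E] [NormedSpace ℂ E] [FiniteDimensional ℂ E]
    (E' : Type) [NormedAddCommGroup E'] [NormedSpace ℂ E'] [FiniteDimensional ℂ E']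
    (e : ComplexDeRhamIsoFamily E) (_ : e.IsNatural)
    (e' : ComplexDeRhamIsoFamily E') (_ : e'.IsNatural)
    (M : Type) [TopologicalSpace M] [ChartedSpace E M] [IsManifold 𝓘(ℂ, E) ω M]
    [IsManifold 𝓘(ℝ, E) ∞ M] [T2Space M] [CompactSpace M]
    (M' : Type) [TopologicalSpace M'] [ChartedSpace E' M'] [IsManifold 𝓘(ℂ, E') ω M']
    [IsManifold 𝓘(ℝ, E') ∞ M'] [T2Space M'] [CompactSpace M']
    [PullbackFacts 𝓘(ℝ, E) M 𝓘(ℝ, E') M' ℂ]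
    (h : M ≃ₜ M') (hh : ContMDiff 𝓘(ℝ, E) 𝓘(ℝ, E') ∞ h)
    (_ : ContMDiff 𝓘(ℝ, E') 𝓘(ℝ, E) ∞ h.symm) (k : ℕ),
    ∃ r : ℂ, ∀ y : complexDeRhamCohomology E' M' k,
      Literature.AlgebraicTopology.SingularHomology.singularCohomology.map ℂ ℂ ⟨h, h.continuous⟩ k
          (e' M' k y) =
        r • e M k (complexDeRhamCohomology.map E hh k y)

/-- Sanity check of the shape of `NaturalDeRhamComparisonRigidity`: in the degenerate instance
`E = E'`, `e = e'`, `M = M'`, `h = id` its conclusion holds with the scalar `r = 1`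
(`id^* = id` on both sides, `singularCohomology.map_id`, `complexDeRhamCohomology.map_id`).
[folklore] -/
theorem naturalDeRhamComparisonRigidity_conclusion_refl (E : Type) [NormedAddCommGroup E]
    [NormedSpace ℂ E] (e : ComplexDeRhamIsoFamily E) (M : Type) [TopologicalSpace M]
    [ChartedSpace E M] [IsManifold 𝓘(ℝ, E) ∞ M] [T2Space M] [SigmaCompactSpace M]
    [PullbackFacts 𝓘(ℝ, E) M 𝓘(ℝ, E) M ℂ] (k : ℕ) :
    ∃ r : ℂ, ∀ y : complexDeRhamCohomology E M k,
      Literature.AlgebraicTopology.SingularHomology.singularCohomology.map ℂ ℂ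
          ⟨Homeomorph.refl M, (Homeomorph.refl M).continuous⟩ k (e M k y) =
        r • e M k (complexDeRhamCohomology.map E
          (contMDiff_id : ContMDiff 𝓘(ℝ, E) 𝓘(ℝ, E) ∞ (Homeomorph.refl M)) k y) := by
  refine ⟨1, fun y ↦ ?_⟩
  have h1 : (⟨Homeomorph.refl M, (Homeomorph.refl M).continuous⟩ : C(M, M)) = ContinuousMap.id M :=
    rfl
  have h2 : complexDeRhamCohomology.map E
      (contMDiff_id : ContMDiff 𝓘(ℝ, E) 𝓘(ℝ, E) ∞ (Homeomorph.refl M)) k = LinearMap.id :=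
    complexDeRhamCohomology.map_id (E := E) (M := M) k
  rw [h1, h2, one_smul, Literature.AlgebraicTopology.SingularHomology.singularCohomology.map_id]
  rfl

/-! ### The reduction -/

/-- **`hodgePQ_independent_of_hodgeModel` reduced to rigidity and the pull-back calculus.** If
natural de Rham comparisons are rigid across diffeomorphisms (`NaturalDeRhamComparisonRigidity`,
the unprinted ingredient 3) and the pull-back calculus of smooth complex forms holds for all
pairs of manifolds charted on finite-dimensional complex spaces (`PullbackFacts`: the named facts
`IsSmoothFormPullback`, `MextDerivPullback`, Warner 2.22–2.23), then for a smooth projective `X`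
the membership of the pull-back of a class `c ∈ Hᵏ(X(ℂ); ℂ)` in the piece `H^{p,q}` of a Hodge
model does not depend on the model. Ingredients 1 (Serre: `HodgeModel.exists_biholomorph`) and
2 (Voisin I §7.3.2: `hodgePQ_map_eq_of_leftInverse`) are theorems of the tree; see the module
docstring for the proof. [cite: VoisinHodgeI2002, §7.3.2] -/
theorem hodgePQ_independent_of_hodgeModel_of_rigidity (hR : NaturalDeRhamComparisonRigidity)
    (hPB : ∀ (E : Type) [NormedAddCommGroup E] [NormedSpace ℂ E] [FiniteDimensional ℂ E]
      (E' : Type) [NormedAddCommGroup E'] [NormedSpace ℂ E'] [FiniteDimensional ℂ E']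
      (M : Type) [TopologicalSpace M] [ChartedSpace E M] [IsManifold 𝓘(ℝ, E) ∞ M]
      (N : Type) [TopologicalSpace N] [ChartedSpace E' N] [IsManifold 𝓘(ℝ, E') ∞ N],
      PullbackFacts 𝓘(ℝ, E) M 𝓘(ℝ, E') N ℂ) :
    hodgePQ_independent_of_hodgeModel := by
  intro n X hX A A' k p q c hc
  obtain ⟨h, hd, hd', hcomm⟩ := HodgeModel.exists_biholomorph hX A A'
  haveI : CompleteSpace A.model := FiniteDimensional.complete ℂ A.model
  haveI : CompleteSpace A'.model := FiniteDimensional.complete ℂ A'.model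
  -- the carriers are compact: `X(ℂ)` is compact (`X → Spec ℂ` proper, Hartshorne II.4.9; Serre,
  -- GAGA §2 n°7 Prop. 6) and the comparison maps are homeomorphisms
  haveI : AlgebraicGeometry.IsProper X.hom := Motives.IsSmoothProjective.isProper_holds hX
  haveI : CompactSpace (Motives.ComplexPoints X) :=
    Motives.compactSpace_algPoints_of_isProper_holds X ℂ
  haveI : CompactSpace A.carrier := A.isAnalytification.homeomorph.symm.compactSpace
  haveI : CompactSpace A'.carrier := A'.isAnalytification.homeomorph.symm.compactSpace
  haveI := hPB A.model A'.model A.carrier A'.carrier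
  haveI := hPB A'.model A.model A'.carrier A.carrier
  haveI := hPB A.model A.model A.carrier A.carrier
  have hh : ContMDiff 𝓘(ℝ, A.model) 𝓘(ℝ, A'.model) ∞ h := hd.contMDiff_real_of_complex
  have hh' : ContMDiff 𝓘(ℝ, A'.model) 𝓘(ℝ, A.model) ∞ h.symm := hd'.contMDiff_real_of_complex
  -- (2) the biholomorphism identifies the `H^{p,q}` of the de Rham sides
  have hPQ := Literature.NumberTheory.Transcendental.hodgePQ_map_eq_of_leftInverse hh hd hh' hd'
    h.symm_apply_apply k p q
  -- singular side: `A.pullback = h^* ∘ A'.pullback`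
  set hs := Literature.AlgebraicTopology.SingularHomology.singularCohomology.map ℂ ℂ
    (⟨h, h.continuous⟩ : C(A.carrier, A'.carrier)) k with hs_def
  have hinj : Function.Injective hs :=
    (Literature.AlgebraicTopology.SingularHomology.singularCohomology.mapIso (R := ℂ) (M := ℂ)
      h k).toLinearEquiv.injective
  have hx : A.pullback k c = hs (A'.pullback k c) := A.pullback_eq_map_pullback A' h hcomm k c
  -- unfold the hypothesis: `h^*(A'.pullback c) = e_A (h^*_dR w)` with `w ∈ H^{p,q}(A'.carrier)`
  change A.pullback k c ∈ (Literature.NumberTheory.Transcendental.hodgePQ A.model A.carrier k p q).map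
      (A.deRham A.carrier k).toLinearMap at hc
  rw [← hPQ, ← Submodule.map_comp] at hc
  obtain ⟨w, hw, hwx⟩ := hc
  rw [hx] at hwx
  -- (3) rigidity: `h^*(e_{A'} w) = r • e_A (h^*_dR w) = h^*(r • A'.pullback c)`
  obtain ⟨r, hr⟩ := hR A.model A'.model A.deRham A.deRham_isNatural A'.deRham A'.deRham_isNatural
    A.carrier A'.carrier h hh hh' k
  have hrw : hs (A'.deRham A'.carrier k w) = hs (r • A'.pullback k c) := by
    rw [hr w, map_smul, ← hwx]
    rfl
  have hew : A'.deRham A'.carrier k w = r • A'.pullback k c := hinj hrw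
  change A'.pullback k c ∈ (Literature.NumberTheory.Transcendental.hodgePQ A'.model A'.carrier k p q).map
      (A'.deRham A'.carrier k).toLinearMap
  by_cases hr0 : r = 0
  · -- then `e_{A'} w = 0`, so `w = 0`, so `h^*(A'.pullback c) = 0` and `A'.pullback c = 0`
    rw [hr0, zero_smul, LinearEquiv.map_eq_zero_iff] at hew
    rw [hew, map_zero] at hwx
    have h0 : A'.pullback k c = 0 := hinj (by rw [← hwx, map_zero])
    rw [h0]
    exact Submodule.zero_mem _
  · refine ⟨r⁻¹ • w, Submodule.smul_mem _ _ hw, ?_⟩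
    rw [LinearEquiv.coe_toLinearMap, map_smul, hew, smul_smul, inv_mul_cancel₀ hr0, one_smul]

end HodgeTheory

end Literature.AlgebraicGeometry.HodgeTheory
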